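import Summits.SmoothPoincare4.SmoothPoincare4.Theorems.ConvexBisectionAcyclicBisectionExistsDualHandleSeamModelChartInverse
import HarnessLib

/-!
# Dual handles, XII: the model chart is a smooth embedding with open range
(brick (ii-f) of the sub-goal T3b "the complement of the prefix sub-handlebody is the other piece
with the DUAL suffix handles" of stub `stub_steinRealisation` (NF6), line `modp-braid-orbits` r11,
crux `ConvexBisection.AcyclicBisectionExists`, item stmt-SmoothPoincare4-10508; wave 2, lead c5)

Sequel of `…DualHandleSeamModelChartInverse.lean` (the explicit inverse `modelChartInv` of the model
chart `modelChart D j G a = ι ∘ (seamPt, seamHeight)`, smooth on `invDom`, images of open subsets of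
the seam locus are open).  Here:

* **`isSmoothEmbedding_modelChart`** — for every non-empty open `U` inside the seam locus
  `{x_μ ≠ 0, ‖x_λ‖ < 1, 1 - ‖x‖² < a}`, the restriction `fun x : U => modelChart D j G a x` is a
  smooth embedding `𝓘(ℝ, ℝ⁴) → 𝓡 4` of the open submanifold `U ⊆ ℝ⁴` into Milnor's gluing
  `G.d₂.Glued`, with OPEN range (the criterion `isSmoothEmbedding_of_contMDiffOn_symm`: an open
  topological embedding, smooth, whose inverse `modelChartInv ∘ ι⁻¹` is smooth on the range — `ι⁻¹`
  by `contMDiffOn_symm_of_isSmoothEmbedding` for the two open smooth embeddings `d₁.inl`, `d₂.inl`);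
* `helper_isSmoothEmbedding_modelChart` (registered).

This is the form in which the long pole of T3b uses the chart: smooth functions on the model pull back
to smooth functions on the glued manifold near the belt circle (`Hⱼ ∘ Ξ⁻¹`), and model embeddings
`𝓕` give embeddings `Ξ ∘ 𝓕`.  Everything here is proved; no named facts.

## References
* J. M. Lee, *Introduction to Smooth Manifolds* (2013), Prop. 5.2, Thm. 4.14. [LeeSmoothManifolds2013]
* J. Milnor, *Lectures on the h-cobordism theorem* (1965), Thm. 1.4. [MilnorHCobordism1965]
-/

noncomputable section

-- the prescribed namespace `Summit.<P>.<Sub>.…` duplicates `SmoothPoincare4` (P = Sub)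
set_option linter.dupNamespace false

open scoped Manifold ContDiff Topology

namespace Summit.SmoothPoincare4.SmoothPoincare4.Theorems.AcyclicBisectionExists.ModpBraidOrbits

open Set Function Metric Topology
open Literature.Topology.FourManifolds Literature.Topology.FourManifolds.HandleAttachingMap

section Embedding

variable {B : Type} [TopologicalSpace B] [T2Space B] [ChartedSpace (EuclideanHalfSpace 4) B]
  {ι : Type} [Finite ι] {h : ι → HandleAttachingMap 3 2 B}
  {X : Type} [TopologicalSpace X] [ChartedSpace (EuclideanHalfSpace 4) X] [IsManifold (𝓡∂ 4) ∞ X]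
  (D : MultiAttachmentData h (𝓡∂ 4) X) (j : ι) {bX : BoundaryData (𝓡∂ 4) X (𝓡 3)}
  {W : Type} [TopologicalSpace W] [ChartedSpace (EuclideanHalfSpace 4) W]
  [IsManifold (𝓡∂ 4) ∞ W] {bW : BoundaryData (𝓡∂ 4) W (𝓡 3)} [Nonempty bX.carrier]

/-- **THE MODEL CHART IS A SMOOTH EMBEDDING WITH OPEN RANGE** on every non-empty open subset `U` of
the seam locus `{x_μ ≠ 0, ‖x_λ‖ < 1, 1 - ‖x‖² < a}` (`0 < a`). [cite: LeeSmoothManifolds2013, Thm. 4.14] -/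
theorem isSmoothEmbedding_modelChart (G : BoundaryGlueData bX bW) {a : ℝ} (ha : 0 < a)
    (U : TopologicalSpace.Opens (EuclideanSpace ℝ (Fin 4))) [Nonempty U]
    (hU : (U : Set (EuclideanSpace ℝ (Fin 4))) ⊆ {x | muPart x ≠ 0 ∧ ‖lamPart x‖ < 1 ∧ 1 - ‖x‖ ^ 2 < a}) :
    Manifold.IsSmoothEmbedding 𝓘(ℝ, EuclideanSpace ℝ (Fin 4)) (𝓡 4) ∞ (fun x : U => modelChart D j G a x) ∧
      IsOpen (range fun x : U => modelChart D j G a x) := by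
  set jU : U → G.d₂.Glued := fun x => modelChart D j G a x with hjU
  set Θ : EuclideanSpace ℝ (Fin 4) → bX.carrier × ℝ := fun x => (seamPt D j bX x, seamHeight a x) with hΘ
  have hjΘ : ∀ x : U, jU x = G.d₂.inl (G.d₁.inl (Θ x)) := fun x => rfl
  -- continuity, injectivity, openness
  have hsm : ContMDiff 𝓘(ℝ, EuclideanSpace ℝ (Fin 4)) (𝓡 4) ∞ jU :=
    (contMDiffOn_modelChart D j bX G a).comp_contMDiff contMDiff_subtype_val fun x => hU x.2
  have hinj : Injective jU := fun x y hxy =>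
    Subtype.ext (injOn_modelChart D j bX G ha (hU x.2) (hU y.2) hxy)
  have himage : ∀ O : Set U, IsOpen O → IsOpen (jU '' O) := by
    intro O hO
    obtain ⟨O', hO', rfl⟩ := isOpen_induced_iff.1 hO
    have h1 : jU '' (Subtype.val ⁻¹' O') = G.d₂.inl '' (G.d₁.inl '' (Θ '' (O' ∩ (U : Set _)))) := by
      ext p
      simp only [mem_image, mem_preimage, mem_inter_iff]
      constructor
      · rintro ⟨x, hx, rfl⟩
        exact ⟨_, ⟨_, ⟨x.1, ⟨hx, x.2⟩, rfl⟩, rfl⟩, (hjΘ x).symm⟩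
      · rintro ⟨_, ⟨_, ⟨y, ⟨hy, hyU⟩, rfl⟩, rfl⟩, rfl⟩
        exact ⟨⟨y, hyU⟩, hy, hjΘ _⟩
    rw [h1]
    exact G.d₂.isOpenMap_inl _ (G.d₁.isOpenMap_inl _
      (isOpen_image_seam D j bX ha (hO'.inter U.isOpen) fun x hx => hU hx.2))
  have hopen : IsOpenMap jU := fun O hO => himage O hO
  have hk : IsOpenEmbedding jU := IsOpenEmbedding.of_continuous_injective_isOpenMap hsm.continuous hinj hopen
  refine ⟨isSmoothEmbedding_of_contMDiffOn_symm hk hsm ?_, hk.isOpen_range⟩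
  -- the inverse on the range: `modelChartInv ∘ seam⁻¹ ∘ (d₂.inl)⁻¹`
  haveI : Nonempty G.d₁.Glued := ⟨G.d₁.inl (Classical.arbitrary _, 0)⟩
  set ι₂ := G.d₂.isOpenEmbedding_inl.toOpenPartialHomeomorph G.d₂.inl with hι₂
  have h₂ : ContMDiffOn (𝓡 4) 𝓘(ℝ, EuclideanSpace ℝ (Fin 4)) ∞ ι₂.symm (range G.d₂.inl) :=
    contMDiffOn_symm_of_isSmoothEmbedding G.d₂.isSmoothEmbedding_inl G.d₂.isOpenEmbedding_inl
  have h₁ := G.contMDiffOn_seam_symm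
  have h₀ := contMDiffOn_modelChartInv D j bX a
  have hcomp : ContMDiffOn (𝓡 4) 𝓘(ℝ, EuclideanSpace ℝ (Fin 4)) ∞
      (fun p => modelChartInv D j bX a (G.seam.symm (ι₂.symm p))) (range jU) := by
    refine h₀.comp (h₁.comp (h₂.mono ?_) ?_) ?_
    · rintro _ ⟨x, rfl⟩; exact ⟨_, (hjΘ x).symm⟩
    · rintro _ ⟨x, rfl⟩
      show ι₂.symm (jU x) ∈ range G.d₁.inl
      rw [hjΘ, hι₂, IsOpenEmbedding.toOpenPartialHomeomorph_left_inv]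
      exact mem_range_self _
    · rintro _ ⟨x, rfl⟩
      show G.seam.symm (ι₂.symm (jU x)) ∈ invDom D j bX a
      rw [hjΘ, hι₂, IsOpenEmbedding.toOpenPartialHomeomorph_left_inv, G.seam_symm_inl]
      exact seam_mem_invDom D j bX ha (hU x.2).1 (hU x.2).2.1 (hU x.2).2.2
  -- compare with the abstract inverse, through `Subtype.val`
  intro p hp
  rw [← ContMDiffWithinAt.subtypeVal_comp_iff]
  refine (hcomp p hp).congr (fun q hq => ?_) ?_
  · obtain ⟨x, rfl⟩ := hq
    show ((hk.toOpenPartialHomeomorph jU).symm (jU x) : EuclideanSpace ℝ (Fin 4)) = _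
    rw [IsOpenEmbedding.toOpenPartialHomeomorph_left_inv, hjΘ, hι₂,
      IsOpenEmbedding.toOpenPartialHomeomorph_left_inv, G.seam_symm_inl]
    exact (modelChartInv_seamPt D j bX ha (hU x.2).1 (hU x.2).2.1 (hU x.2).2.2).symm
  · obtain ⟨x, rfl⟩ := hp
    show ((hk.toOpenPartialHomeomorph jU).symm (jU x) : EuclideanSpace ℝ (Fin 4)) = _
    rw [IsOpenEmbedding.toOpenPartialHomeomorph_left_inv, hjΘ, hι₂,
      IsOpenEmbedding.toOpenPartialHomeomorph_left_inv, G.seam_symm_inl]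
    exact (modelChartInv_seamPt D j bX ha (hU x.2).1 (hU x.2).2.1 (hU x.2).2.2).symm

/-- **Registered helper `helper_isSmoothEmbedding_modelChart` (brick (ii-f) of T3b, sub-goal of NF6
`stub_steinRealisation`, wave 2, lead c5): the model chart of Milnor's gluing around a belt circle is a
smooth embedding with open range on every open subset of the seam locus.**
[cite: LeeSmoothManifolds2013, Thm. 4.14] -/
theorem helper_isSmoothEmbedding_modelChart : ∀ {B : Type} [TopologicalSpace B] [T2Space B] [ChartedSpace (EuclideanHalfSpace 4) B] {ι : Type} [Finite ι] {h : ι → Literature.Topology.FourManifolds.HandleAttachingMap 3 2 B} {X : Type} [TopologicalSpace X] [ChartedSpace (EuclideanHalfSpace 4) X] [IsManifold (𝓡∂ 4) ∞ X] (D : Literature.Topology.FourManifolds.HandleAttachingMap.MultiAttachmentData h (𝓡∂ 4) X) (j : ι) {bX : Literature.Topology.FourManifolds.BoundaryData (𝓡∂ 4) X (𝓡 3)} {W : Type} [TopologicalSpace W] [ChartedSpace (EuclideanHalfSpace 4) W] [IsManifold (𝓡∂ 4) ∞ W] {bW : Literature.Topology.FourManifolds.BoundaryData (𝓡∂ 4)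 W (𝓡 3)} [Nonempty bX.carrier] (G : Literature.Topology.FourManifolds.BoundaryGlueData bX bW) {a : ℝ}, 0 < a → ∀ (U : TopologicalSpace.Opens (EuclideanSpace ℝ (Fin 4))) [Nonempty U], (U : Set (EuclideanSpace ℝ (Fin 4))) ⊆ {x | Literature.Topology.FourManifolds.muPart x ≠ 0 ∧ ‖Literature.Topology.FourManifolds.lamPart x‖ < 1 ∧ 1 - ‖x‖ ^ 2 < a} → Manifold.IsSmoothEmbedding 𝓘(ℝ, EuclideanSpace ℝ (Fin 4)) (𝓡 4) ∞ (fun x : U => Summit.SmoothPoincare4.SmoothPoincare4.Theorems.AcyclicBisectionExists.ModpBraidOrbits.modelChart D j G a x) ∧ IsOpen (Set.range fun x : U => Summit.SmoothPoincare4.SmoothPoincare4.Theorems.AcyclicBisectionExists.ModpBraidOrbits.modelChart D j G a x) :=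
  by
  intro B _ _ _ ι _ h X _ _ _ D j bX W _ _ _ bW _ G a ha U _ hU
  exact isSmoothEmbedding_modelChart D j G ha U hU

end Embedding

end Summit.SmoothPoincare4.SmoothPoincare4.Theorems.AcyclicBisectionExists.ModpBraidOrbits

end
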